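/-
Copyright (c) 2026 the pub-hodgecm-mathlib formalisation cell (harness21).  Prover seat hodgecm-mathlib-K2E3-p11 (g5), Track B «K2-LIT» ∕ h413
(`stmt-HodgeConjecture-24833`), line `K2_E3_EllipticInputs`, unit U12 §L, Richardson road for (LBGL-ge3) at `N = 3` (road owner K2E3-p11), brick (F-E) =
(LBGL-3E) «THE (2,1)-PARABOLIC SLICE DENSITY OF 𝔤𝔩₃(F)», FILE E″1 «THE PARABOLIC CHART AT A BLOCK-REGULAR LEVI POINT: ALGEBRA, DETERMINANT, STRICT DERIVATIVE».
2026-09-04.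
-/
import Summits.HodgeConjecture.HodgeConjecture.Theorems.K2E3GL3ParabolicNilTwist      -- ★ p857618 (K2E3-p21 g4, (F-E)-A′): `eval_charpoly_fin_two` (the currency `χ_A(m₄)`)
import Literature.Analysis.Matrix.UltrametricElementwiseNormCalculus      -- ★ (F0P3a-p05): `norm_mul_le_of_isUltrametricDist` (elementwise sup norm is submultiplicative)
import Mathlib.LinearAlgebra.Matrix.Charpoly.Coeff
import Mathlib.LinearAlgebra.Determinant
import Mathlib.Topology.Algebra.Module.FiniteDimension
import Mathlib.Analysis.Normed.Module.FiniteDimension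
import HarnessLib

/-!
# K2_E3 road (h413), §L ∕ Richardson road at `N = 3`, brick (F-E) FILE E″1: the parabolic chart `Φ_m(X) = Ad(1 + L X)(M(m) + X_𝔭)` — algebra, `det`, strict derivative

Cell `pub/hodgecm-mathlib` (D-0151), Track B, seat K2E3-p11 (g5) (road owner of (F-E) = (LBGL-3E) `sig_K2E3GL3ParabolicSliceDensity`; ROAD v2 on `K2/STATUS.md`,
2026-09-04).  `--supports stmt-HodgeConjecture-24833 --as helper`; THEOREMS ONLY (no definition ∕ instance ∕ notation ∕ named fact ∕ `sorry`); never imports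
`Cruxes/…/Lines`.  COUNT-NEUTRAL.  The (2,1)-parabolic twin of ★ p857621 `K2E3GL3OrbitChartDeriv` (K2E3-p17 (g6)); FILE E″2 `K2E3GL3ParabolicOrbitChart` feeds it to
★ `exists_depth_chart`.

THE POINT.  Let `𝔭 ⊂ 𝔤𝔩₃` be the standard `(2,1)`-parabolic subalgebra (rows `0, 1` arbitrary, row `2 = (0, 0, *)`), `𝔫⁻` the opposite nilradical (entries `(2,0), (2,1)`),
`M(m) = [[m₀, m₁, 0], [m₂, m₃, 0], [0, 0, m₄]]` a Levi point, `A = [[m₀, m₁], [m₂, m₃]]`, `χ(m) = χ_A(m₄) = (m₄ − m₀)(m₄ − m₃) − m₁ m₂`.  The polynomial map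
  `Φ_m(X) = (1 + L X) · (M(m) + X_𝔭) · (1 − L X)`,   `L X = [[0,0,0],[0,0,0],[X₂₀, X₂₁, 0]]`, `X_𝔭 = X − L X`
(`(L X)² = 0`, so `1 − L X = (1 + L X)⁻¹` and `Φ_m(X) = Ad(1 + L X)(M(m) + X_𝔭)`) has strict derivative at `0`
  `e_m(v) = [L v, M(m)] + v_𝔭`  = identity on the `𝔭`-coordinates, `(v₂₀, v₂₁) ↦ (v₂₀, v₂₁)·(A − m₄·1)` on the `𝔫⁻`-row,
a linear automorphism iff `χ(m) ≠ 0` (`(G, M)`-regularity), with `det e_m = det(A − m₄·1) = χ(m)`.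
* §1 algebra over a commutative ring: `(L X)(L Y) = 0`, `(1 + L X)(1 − L X) = 1`, `Φ_m(X) = g (M(m) + X_𝔭) g⁻¹` (`g ∈ GL₃`), `charpoly` invariance, `Φ_m(0) = M(m)`,
  the entrywise derivative identity, and the `2 × 2` determinant of the row action (`χ(m)` = ★ A′ `eval_charpoly_fin_two`).
* §1b over a field: **`det_rowAction`** — `det e = χ(m)` for any linear automorphism `e` acting as the row action (`LinearMap.det_conj` + `det_prodMap` + `det_toLin'`
  along the coordinate split `M₃(K) ≃ K² × K⁷`).
* §2 over a complete ultrametric normed field `K` (elementwise sup norm): **`exists_rowActionEquiv`** (`e_m` as a continuous linear AUTOMORPHISM) and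
  **`hasStrictFDerivAt_parabolicChart_of`** ∕ **`hasStrictFDerivAt_parabolicChart`** — `HasStrictFDerivAt Φ_m e_m 0`, ONE inline `NormedRing ∕ NormedAlgebra` frame (the
  method of ★ `UltrametricElementwiseNormCalculus` ∕ ★ E1 p857621).
[HarishChandra1970, Part V §4 Lemma 22] [Schikhof1984, §27 Lemma 27.4–Thm. 27.5]
HONEST LABEL: HC_CM is proved only modulo the 7 printed citations (2 remaining named inputs: hLiu418 = stmt-HodgeConjecture-24832, h413 = stmt-HodgeConjecture-24833)
until rung 0 closes; count-neutral helper ((LBGL-ge3)∕(LBGL-3E) NOT ★ here).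

## References
* [HarishChandra1970] Harish-Chandra (van Dijk), *Harmonic Analysis on Reductive p-adic Groups*, LNM 162 (1970), Part V §4 Lemma 22.
* [Schikhof1984] W. H. Schikhof, *Ultrametric Calculus* (1984), §27 Lemma 27.4–Thm. 27.5.
-/

set_option autoImplicit false
set_option linter.dupNamespace false

noncomputable section

open Filter Topology Set Matrix
open scoped MatrixGroups NNReal

namespace Summit.HodgeConjecture.HodgeConjecture.Cruxes.H413.K2E3GL3ParabolicChartDeriv

/-! ## §1  Algebra over a commutative ring -/

section Algebra

variable {R : Type*} [CommRing R]

/-- `(L X)(L Y) = 0` for the `𝔫⁻`-parts (row `2`, columns `0, 1`). [folklore] -/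
theorem lowerRow_mul_lowerRow (X Y : Matrix (Fin 3) (Fin 3) R) :
    (!![0, 0, 0; 0, 0, 0; X 2 0, X 2 1, 0] : Matrix (Fin 3) (Fin 3) R) * !![0, 0, 0; 0, 0, 0; Y 2 0, Y 2 1, 0] = 0 := by
  ext i j; fin_cases i <;> fin_cases j <;> simp [Matrix.mul_apply, Fin.sum_univ_three]

/-- `(1 + L X)(1 − L X) = 1`. [folklore] -/
theorem one_add_lowerRow_mul_one_sub (X : Matrix (Fin 3) (Fin 3) R) :
    (1 + (!![0, 0, 0; 0, 0, 0; X 2 0, X 2 1, 0] : Matrix (Fin 3) (Fin 3) R)) * (1 - !![0, 0, 0; 0, 0, 0; X 2 0, X 2 1, 0]) = 1 := by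
  rw [add_mul, mul_sub, mul_sub, one_mul, one_mul, mul_one, lowerRow_mul_lowerRow, sub_zero, sub_add_cancel]

/-- `(1 − L X)(1 + L X) = 1`. [folklore] -/
theorem one_sub_lowerRow_mul_one_add (X : Matrix (Fin 3) (Fin 3) R) :
    (1 - (!![0, 0, 0; 0, 0, 0; X 2 0, X 2 1, 0] : Matrix (Fin 3) (Fin 3) R)) * (1 + !![0, 0, 0; 0, 0, 0; X 2 0, X 2 1, 0]) = 1 := by
  rw [sub_mul, mul_add, mul_add, one_mul, one_mul, mul_one, lowerRow_mul_lowerRow, add_zero, add_sub_cancel_right]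

/-- **The group part of the chart is invertible**: `1 + L X ∈ GL₃(R)` with inverse `1 − L X`. [folklore] -/
theorem exists_unit_lowerRow (X : Matrix (Fin 3) (Fin 3) R) :
    ∃ g : GL (Fin 3) R, (g : Matrix (Fin 3) (Fin 3) R) = 1 + !![0, 0, 0; 0, 0, 0; X 2 0, X 2 1, 0] ∧
      ((g⁻¹ : GL (Fin 3) R) : Matrix (Fin 3) (Fin 3) R) = 1 - !![0, 0, 0; 0, 0, 0; X 2 0, X 2 1, 0] :=
  ⟨⟨1 + !![0, 0, 0; 0, 0, 0; X 2 0, X 2 1, 0], 1 - !![0, 0, 0; 0, 0, 0; X 2 0, X 2 1, 0], one_add_lowerRow_mul_one_sub X, one_sub_lowerRow_mul_one_add X⟩,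
    rfl, rfl⟩

/-- `X = L X + X_𝔭` (`𝔫⁻`-part + `𝔭`-part). [folklore] -/
theorem lowerRow_add_parabolicPart (X : Matrix (Fin 3) (Fin 3) R) :
    (!![0, 0, 0; 0, 0, 0; X 2 0, X 2 1, 0] : Matrix (Fin 3) (Fin 3) R) + !![X 0 0, X 0 1, X 0 2; X 1 0, X 1 1, X 1 2; 0, 0, X 2 2] = X := by
  ext i j; fin_cases i <;> fin_cases j <;> simp

/-- **The chart is a conjugate of a parabolic element**: `Φ_m(X) = g · (M(m) + X_𝔭) · g⁻¹` with `g = 1 + L X ∈ GL₃(R)`. [cite: HarishChandra1970, Part V §4 Lemma 22] -/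
theorem exists_parabolicChart_eq_conj (m : Fin 5 → R) (X : Matrix (Fin 3) (Fin 3) R) :
    ∃ g : GL (Fin 3) R, (g : Matrix (Fin 3) (Fin 3) R) = 1 + !![0, 0, 0; 0, 0, 0; X 2 0, X 2 1, 0] ∧
      (1 + (!![0, 0, 0; 0, 0, 0; X 2 0, X 2 1, 0] : Matrix (Fin 3) (Fin 3) R)) *
          (!![m 0, m 1, 0; m 2, m 3, 0; 0, 0, m 4] + !![X 0 0, X 0 1, X 0 2; X 1 0, X 1 1, X 1 2; 0, 0, X 2 2]) *
          (1 - !![0, 0, 0; 0, 0, 0; X 2 0, X 2 1, 0]) =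
        (g : Matrix (Fin 3) (Fin 3) R) * (!![m 0, m 1, 0; m 2, m 3, 0; 0, 0, m 4] + !![X 0 0, X 0 1, X 0 2; X 1 0, X 1 1, X 1 2; 0, 0, X 2 2]) *
          ((g⁻¹ : GL (Fin 3) R) : Matrix (Fin 3) (Fin 3) R) := by
  obtain ⟨g, hg, hginv⟩ := exists_unit_lowerRow X
  exact ⟨g, hg, by rw [hg, hginv]⟩

/-- `charpoly (Φ_m X) = charpoly (M(m) + X_𝔭)`. [folklore] -/
theorem charpoly_parabolicChart (m : Fin 5 → R) (X : Matrix (Fin 3) (Fin 3) R) :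
    ((1 + (!![0, 0, 0; 0, 0, 0; X 2 0, X 2 1, 0] : Matrix (Fin 3) (Fin 3) R)) *
          (!![m 0, m 1, 0; m 2, m 3, 0; 0, 0, m 4] + !![X 0 0, X 0 1, X 0 2; X 1 0, X 1 1, X 1 2; 0, 0, X 2 2]) *
          (1 - !![0, 0, 0; 0, 0, 0; X 2 0, X 2 1, 0])).charpoly =
      (!![m 0, m 1, 0; m 2, m 3, 0; 0, 0, m 4] + !![X 0 0, X 0 1, X 0 2; X 1 0, X 1 1, X 1 2; 0, 0, X 2 2] : Matrix (Fin 3) (Fin 3) R).charpoly := by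
  obtain ⟨g, -, h⟩ := exists_parabolicChart_eq_conj m X
  rw [h, Matrix.coe_units_inv]
  exact Matrix.charpoly_units_conj g _

/-- `Φ_m(0) = M(m)`. [folklore] -/
theorem parabolicChart_zero (m : Fin 5 → R) :
    (fun X : Matrix (Fin 3) (Fin 3) R =>
        (1 + (!![0, 0, 0; 0, 0, 0; X 2 0, X 2 1, 0] : Matrix (Fin 3) (Fin 3) R)) *
          (!![m 0, m 1, 0; m 2, m 3, 0; 0, 0, m 4] + !![X 0 0, X 0 1, X 0 2; X 1 0, X 1 1, X 1 2; 0, 0, X 2 2]) *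
          (1 - !![0, 0, 0; 0, 0, 0; X 2 0, X 2 1, 0])) 0 =
      !![m 0, m 1, 0; m 2, m 3, 0; 0, 0, m 4] := by
  have hL : (!![0, 0, 0; 0, 0, 0; (0 : Matrix (Fin 3) (Fin 3) R) 2 0, (0 : Matrix (Fin 3) (Fin 3) R) 2 1, 0] : Matrix (Fin 3) (Fin 3) R) = 0 := by
    ext i j; fin_cases i <;> fin_cases j <;> rfl
  have hP : (!![(0 : Matrix (Fin 3) (Fin 3) R) 0 0, (0 : Matrix (Fin 3) (Fin 3) R) 0 1, (0 : Matrix (Fin 3) (Fin 3) R) 0 2;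
      (0 : Matrix (Fin 3) (Fin 3) R) 1 0, (0 : Matrix (Fin 3) (Fin 3) R) 1 1, (0 : Matrix (Fin 3) (Fin 3) R) 1 2;
      0, 0, (0 : Matrix (Fin 3) (Fin 3) R) 2 2] : Matrix (Fin 3) (Fin 3) R) = 0 := by
    ext i j; fin_cases i <;> fin_cases j <;> rfl
  simp only [hL, hP, add_zero, sub_zero, Matrix.one_mul, Matrix.mul_one]

/-- The entrywise value of the product-rule derivative of `Φ_m` at `0`: `(M·(−L v) + (v_𝔭 + (L v)·M))_{ij} = (e_m v)_{ij}`, where `e_m v` is `v` with its `𝔫⁻`-row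
replaced by `(v₂₀, v₂₁)·(A − m₄·1)`. [folklore] -/
theorem derivative_entry_formula (m : Fin 5 → R) (v : Matrix (Fin 3) (Fin 3) R) (i j : Fin 3) :
    ((!![m 0, m 1, 0; m 2, m 3, 0; 0, 0, m 4] : Matrix (Fin 3) (Fin 3) R) * -(!![0, 0, 0; 0, 0, 0; v 2 0, v 2 1, 0] : Matrix (Fin 3) (Fin 3) R) +
        ((!![v 0 0, v 0 1, v 0 2; v 1 0, v 1 1, v 1 2; 0, 0, v 2 2] : Matrix (Fin 3) (Fin 3) R) +
          (!![0, 0, 0; 0, 0, 0; v 2 0, v 2 1, 0] : Matrix (Fin 3) (Fin 3) R) * !![m 0, m 1, 0; m 2, m 3, 0; 0, 0, m 4])) i j =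
      (!![v 0 0, v 0 1, v 0 2; v 1 0, v 1 1, v 1 2; v 2 0 * (m 0 - m 4) + v 2 1 * m 2, v 2 0 * m 1 + v 2 1 * (m 3 - m 4), v 2 2] :
        Matrix (Fin 3) (Fin 3) R) i j := by
  fin_cases i <;> fin_cases j <;> (simp; try ring)

/-- The matrix `N = [[m₀ − m₄, m₂], [m₁, m₃ − m₄]]` of the `𝔫⁻`-row action `y ↦ y·(A − m₄·1)` (as `N *ᵥ y`) has `det N = χ_A(m₄)`. [folklore] -/
theorem det_rowActionMatrix (m : Fin 5 → R) :
    (!![m 0 - m 4, m 2; m 1, m 3 - m 4] : Matrix (Fin 2) (Fin 2) R).det = (!![m 0, m 1; m 2, m 3] : Matrix (Fin 2) (Fin 2) R).charpoly.eval (m 4) := by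
  rw [K2E3GL3ParabolicNilTwist.eval_charpoly_fin_two, Matrix.det_fin_two]
  simp only [Matrix.of_apply, Matrix.cons_val', Matrix.cons_val_zero, Matrix.cons_val_one, Matrix.cons_val_fin_one, Matrix.empty_val']
  ring

end Algebra

/-! ## §1b  The determinant of the row action on `M₃(K)` over a field: `det e_m = χ_A(m₄)` -/

section Det

variable {K : Type*} [Field K]

/-- **`det e_m = χ_A(m₄)`** for ANY linear automorphism `e` of `M₃(K)` acting as the row action (`𝔭`-coordinates fixed, `𝔫⁻`-row `↦ (v₂₀, v₂₁)·(A − m₄·1)`):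
conjugate by the coordinate split `M₃(K) ≃ K² × K⁷` to `(N *ᵥ ·) × id`, `N = [[m₀ − m₄, m₂], [m₁, m₃ − m₄]]`, and read `det` (`LinearMap.det_conj`, `det_prodMap`,
`det_toLin'`). [folklore] -/
theorem det_rowAction (m : Fin 5 → K) (e : Matrix (Fin 3) (Fin 3) K ≃ₗ[K] Matrix (Fin 3) (Fin 3) K)
    (he : ∀ X, e X = !![X 0 0, X 0 1, X 0 2; X 1 0, X 1 1, X 1 2; X 2 0 * (m 0 - m 4) + X 2 1 * m 2, X 2 0 * m 1 + X 2 1 * (m 3 - m 4), X 2 2]) :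
    (LinearEquiv.det e : K) = (!![m 0, m 1; m 2, m 3] : Matrix (Fin 2) (Fin 2) K).charpoly.eval (m 4) := by
  classical
  -- the coordinate split `S : M₃(K) ≃ₗ K² × K⁷` (`𝔫⁻`-row ; the seven `𝔭`-coordinates)
  let S : Matrix (Fin 3) (Fin 3) K ≃ₗ[K] (Fin 2 → K) × (Fin 7 → K) :=
    { toFun := fun X => (![X 2 0, X 2 1], ![X 0 0, X 0 1, X 0 2, X 1 0, X 1 1, X 1 2, X 2 2])
      invFun := fun p => !![p.2 0, p.2 1, p.2 2; p.2 3, p.2 4, p.2 5; p.1 0, p.1 1, p.2 6]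
      map_add' := fun X Y => by
        refine Prod.ext ?_ ?_
        · funext k; fin_cases k <;> rfl
        · funext k; fin_cases k <;> rfl
      map_smul' := fun a X => by
        refine Prod.ext ?_ ?_
        · funext k; fin_cases k <;> rfl
        · funext k; fin_cases k <;> rfl
      left_inv := fun X => by ext i j; fin_cases i <;> fin_cases j <;> rfl
      right_inv := fun p => by
        refine Prod.ext ?_ ?_
        · funext k; fin_cases k <;> rfl
        · funext k; fin_cases k <;> rfl }
  have hS : ∀ X, S X = (![X 2 0, X 2 1], ![X 0 0, X 0 1, X 0 2, X 1 0, X 1 1, X 1 2, X 2 2]) := fun X => rfl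
  have hSs : ∀ p, S.symm p = !![p.2 0, p.2 1, p.2 2; p.2 3, p.2 4, p.2 5; p.1 0, p.1 1, p.2 6] := fun p => rfl
  set N : Matrix (Fin 2) (Fin 2) K := !![m 0 - m 4, m 2; m 1, m 3 - m 4] with hN
  have hconj : (S : Matrix (Fin 3) (Fin 3) K →ₗ[K] (Fin 2 → K) × (Fin 7 → K)) ∘ₗ (e : Matrix (Fin 3) (Fin 3) K →ₗ[K] Matrix (Fin 3) (Fin 3) K) ∘ₗ
      (S.symm : (Fin 2 → K) × (Fin 7 → K) →ₗ[K] Matrix (Fin 3) (Fin 3) K) = (Matrix.toLin' N).prodMap LinearMap.id := by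
    refine LinearMap.ext fun p => ?_
    rw [LinearMap.comp_apply, LinearMap.comp_apply, LinearMap.prodMap_apply, LinearMap.id_apply, Matrix.toLin'_apply]
    change S (e (S.symm p)) = _
    rw [hSs, he, hS]
    refine Prod.ext ?_ ?_
    · funext k
      fin_cases k <;> simp [hN, Matrix.mulVec, dotProduct, Fin.sum_univ_two] <;> ring
    · funext k
      fin_cases k <;> simp
  rw [LinearEquiv.coe_det, ← LinearMap.det_conj (e : Matrix (Fin 3) (Fin 3) K →ₗ[K] Matrix (Fin 3) (Fin 3) K) S, hconj, LinearMap.det_prodMap,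
    LinearMap.det_toLin', LinearMap.det_id, mul_one, hN, det_rowActionMatrix]

end Det

/-! ## §2  Analysis over a complete ultrametric normed field `K` (elementwise sup norm on `M₃(K)`): the row-action equivalence and the strict derivative of `Φ_m` at `0` -/

section Normed

open scoped Matrix.Norms.Elementwise

variable {K : Type*} [NontriviallyNormedField K] [CompleteSpace K] [IsUltrametricDist K]

/-- **The row action is a continuous linear automorphism of `M₃(K)`** when `χ(m) = (m₄ − m₀)(m₄ − m₃) − m₁ m₂ ≠ 0` (inverse: the adjugate of `A − m₄·1` over `χ(m)` on the
`𝔫⁻`-row). [folklore] -/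
theorem exists_rowActionEquiv (m : Fin 5 → K) (hm : (m 4 - m 0) * (m 4 - m 3) - m 1 * m 2 ≠ 0) :
    ∃ e : Matrix (Fin 3) (Fin 3) K ≃L[K] Matrix (Fin 3) (Fin 3) K,
      ∀ X, e X = !![X 0 0, X 0 1, X 0 2; X 1 0, X 1 1, X 1 2; X 2 0 * (m 0 - m 4) + X 2 1 * m 2, X 2 0 * m 1 + X 2 1 * (m 3 - m 4), X 2 2] := by
  set χ : K := (m 4 - m 0) * (m 4 - m 3) - m 1 * m 2 with hχ
  have hlin1 : ∀ X : Matrix (Fin 3) (Fin 3) K,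
      χ⁻¹ * ((X 2 0 * (m 0 - m 4) + X 2 1 * m 2) * (m 3 - m 4) - (X 2 0 * m 1 + X 2 1 * (m 3 - m 4)) * m 2) = X 2 0 := by
    intro X
    have : (X 2 0 * (m 0 - m 4) + X 2 1 * m 2) * (m 3 - m 4) - (X 2 0 * m 1 + X 2 1 * (m 3 - m 4)) * m 2 = χ * X 2 0 := by rw [hχ]; ring
    rw [this, ← mul_assoc, inv_mul_cancel₀ hm, one_mul]
  have hlin2 : ∀ X : Matrix (Fin 3) (Fin 3) K,
      χ⁻¹ * (-((X 2 0 * (m 0 - m 4) + X 2 1 * m 2) * m 1) + (X 2 0 * m 1 + X 2 1 * (m 3 - m 4)) * (m 0 - m 4)) = X 2 1 := by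
    intro X
    have : -((X 2 0 * (m 0 - m 4) + X 2 1 * m 2) * m 1) + (X 2 0 * m 1 + X 2 1 * (m 3 - m 4)) * (m 0 - m 4) = χ * X 2 1 := by rw [hχ]; ring
    rw [this, ← mul_assoc, inv_mul_cancel₀ hm, one_mul]
  have hlin3 : ∀ X : Matrix (Fin 3) (Fin 3) K,
      χ⁻¹ * (X 2 0 * (m 3 - m 4) - X 2 1 * m 2) * (m 0 - m 4) + χ⁻¹ * (-(X 2 0 * m 1) + X 2 1 * (m 0 - m 4)) * m 2 = X 2 0 := by
    intro X
    have : χ⁻¹ * (X 2 0 * (m 3 - m 4) - X 2 1 * m 2) * (m 0 - m 4) + χ⁻¹ * (-(X 2 0 * m 1) + X 2 1 * (m 0 - m 4)) * m 2 = χ⁻¹ * (χ * X 2 0) := by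
      rw [hχ]; ring
    rw [this, ← mul_assoc, inv_mul_cancel₀ hm, one_mul]
  have hlin4 : ∀ X : Matrix (Fin 3) (Fin 3) K,
      χ⁻¹ * (X 2 0 * (m 3 - m 4) - X 2 1 * m 2) * m 1 + χ⁻¹ * (-(X 2 0 * m 1) + X 2 1 * (m 0 - m 4)) * (m 3 - m 4) = X 2 1 := by
    intro X
    have : χ⁻¹ * (X 2 0 * (m 3 - m 4) - X 2 1 * m 2) * m 1 + χ⁻¹ * (-(X 2 0 * m 1) + X 2 1 * (m 0 - m 4)) * (m 3 - m 4) = χ⁻¹ * (χ * X 2 1) := by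
      rw [hχ]; ring
    rw [this, ← mul_assoc, inv_mul_cancel₀ hm, one_mul]
  -- the row action as a LINEAR equivalence; finite dimension makes it bi-continuous
  let Le : Matrix (Fin 3) (Fin 3) K ≃ₗ[K] Matrix (Fin 3) (Fin 3) K :=
    { toFun := fun X => !![X 0 0, X 0 1, X 0 2; X 1 0, X 1 1, X 1 2; X 2 0 * (m 0 - m 4) + X 2 1 * m 2, X 2 0 * m 1 + X 2 1 * (m 3 - m 4), X 2 2]
      invFun := fun X => !![X 0 0, X 0 1, X 0 2; X 1 0, X 1 1, X 1 2;
        χ⁻¹ * (X 2 0 * (m 3 - m 4) - X 2 1 * m 2), χ⁻¹ * (-(X 2 0 * m 1) + X 2 1 * (m 0 - m 4)), X 2 2]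
      map_add' := fun X Y => by
        ext i j; fin_cases i <;> fin_cases j <;>
          simp only [Matrix.add_apply, Matrix.of_apply, Matrix.cons_val', Matrix.cons_val_zero, Matrix.cons_val_one, Matrix.cons_val_two,
            Matrix.cons_val_fin_one, Matrix.empty_val', Matrix.vecHead, Matrix.vecTail, Nat.succ_eq_add_one, Nat.reduceAdd, Fin.isValue, Fin.mk_one,
            Fin.reduceFinMk, Fin.zero_eta, Function.comp_apply, Fin.succ_zero_eq_one] <;> ring
      map_smul' := fun a X => by
        ext i j; fin_cases i <;> fin_cases j <;>
          simp only [Matrix.smul_apply, smul_eq_mul, RingHom.id_apply, Matrix.of_apply, Matrix.cons_val', Matrix.cons_val_zero, Matrix.cons_val_one,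
            Matrix.cons_val_two, Matrix.cons_val_fin_one, Matrix.empty_val', Matrix.vecHead, Matrix.vecTail, Nat.succ_eq_add_one, Nat.reduceAdd, Fin.isValue,
            Fin.mk_one, Fin.reduceFinMk, Fin.zero_eta, Function.comp_apply, Fin.succ_zero_eq_one] <;> ring
      left_inv := fun X => by
        ext i j; fin_cases i <;> fin_cases j <;>
          simp only [Matrix.of_apply, Matrix.cons_val', Matrix.cons_val_zero, Matrix.cons_val_one, Matrix.cons_val_two,
            Matrix.cons_val_fin_one, Matrix.empty_val', Matrix.tail_cons, Matrix.head_cons, Nat.succ_eq_add_one, Nat.reduceAdd,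
            Fin.isValue, Fin.mk_one, Fin.reduceFinMk, Fin.zero_eta] <;>
          first | rfl | exact hlin1 X | exact hlin2 X
      right_inv := fun X => by
        ext i j; fin_cases i <;> fin_cases j <;>
          simp only [Matrix.of_apply, Matrix.cons_val', Matrix.cons_val_zero, Matrix.cons_val_one, Matrix.cons_val_two,
            Matrix.cons_val_fin_one, Matrix.empty_val', Matrix.tail_cons, Matrix.head_cons, Nat.succ_eq_add_one, Nat.reduceAdd,
            Fin.isValue, Fin.mk_one, Fin.reduceFinMk, Fin.zero_eta] <;>
          first | rfl | exact hlin3 X | exact hlin4 X }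
  exact ⟨Le.toContinuousLinearEquiv, fun X => rfl⟩

/-- **THE STRICT DERIVATIVE OF THE PARABOLIC CHART AT `0` (for a given row-action map `e`).**  The polynomial map `Φ_m(X) = (1 + L X)(M(m) + X_𝔭)(1 − L X)` on `M₃(K)`
(elementwise sup norm, `K` complete ultrametric) has strict derivative at `0` any continuous linear map `e` acting as the row action — product rule:
`(L v)·M + v_𝔭 − M·(L v) = [L v, M] + v_𝔭`.  All continuous linear maps are built against ONE inline `NormedRing ∕ NormedAlgebra` structure (the method of ★
`UltrametricElementwiseNormCalculus` ∕ ★ E1 p857621); the statement is its definitional re-reading. [cite: HarishChandra1970, Part V §4 Lemma 22] [cite: Schikhof1984, §27] -/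
theorem hasStrictFDerivAt_parabolicChart_of (m : Fin 5 → K) (e : Matrix (Fin 3) (Fin 3) K →L[K] Matrix (Fin 3) (Fin 3) K)
    (he : ∀ X, e X = !![X 0 0, X 0 1, X 0 2; X 1 0, X 1 1, X 1 2; X 2 0 * (m 0 - m 4) + X 2 1 * m 2, X 2 0 * m 1 + X 2 1 * (m 3 - m 4), X 2 2]) :
    HasStrictFDerivAt (fun X : Matrix (Fin 3) (Fin 3) K =>
        (1 + (!![0, 0, 0; 0, 0, 0; X 2 0, X 2 1, 0] : Matrix (Fin 3) (Fin 3) K)) *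
          (!![m 0, m 1, 0; m 2, m 3, 0; 0, 0, m 4] + !![X 0 0, X 0 1, X 0 2; X 1 0, X 1 1, X 1 2; 0, 0, X 2 2]) *
          (1 - !![0, 0, 0; 0, 0, 0; X 2 0, X 2 1, 0])) e 0 := by
  -- the two parts as linear maps (no normed frame yet)
  let Ll : Matrix (Fin 3) (Fin 3) K →ₗ[K] Matrix (Fin 3) (Fin 3) K :=
    { toFun := fun X => !![0, 0, 0; 0, 0, 0; X 2 0, X 2 1, 0]
      map_add' := fun X Y => by
        ext i j; fin_cases i <;> fin_cases j <;>
          simp only [Matrix.add_apply, Matrix.of_apply, Matrix.cons_val', Matrix.cons_val_zero, Matrix.cons_val_one, Matrix.cons_val_two,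
            Matrix.cons_val_fin_one, Matrix.empty_val', Matrix.vecHead, Matrix.vecTail, Nat.succ_eq_add_one, Nat.reduceAdd, Fin.isValue, Fin.mk_one,
            Fin.reduceFinMk, Fin.zero_eta, Function.comp_apply, Fin.succ_zero_eq_one, add_zero]
      map_smul' := fun a X => by
        ext i j; fin_cases i <;> fin_cases j <;>
          simp only [Matrix.smul_apply, smul_eq_mul, mul_zero, RingHom.id_apply, Matrix.of_apply, Matrix.cons_val', Matrix.cons_val_zero, Matrix.cons_val_one,
            Matrix.cons_val_two, Matrix.cons_val_fin_one, Matrix.empty_val', Matrix.vecHead, Matrix.vecTail, Nat.succ_eq_add_one, Nat.reduceAdd, Fin.isValue,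
            Fin.mk_one, Fin.reduceFinMk, Fin.zero_eta, Function.comp_apply, Fin.succ_zero_eq_one] }
  let Lp : Matrix (Fin 3) (Fin 3) K →ₗ[K] Matrix (Fin 3) (Fin 3) K :=
    { toFun := fun X => !![X 0 0, X 0 1, X 0 2; X 1 0, X 1 1, X 1 2; 0, 0, X 2 2]
      map_add' := fun X Y => by
        ext i j; fin_cases i <;> fin_cases j <;>
          simp only [Matrix.add_apply, Matrix.of_apply, Matrix.cons_val', Matrix.cons_val_zero, Matrix.cons_val_one, Matrix.cons_val_two,
            Matrix.cons_val_fin_one, Matrix.empty_val', Matrix.vecHead, Matrix.vecTail, Nat.succ_eq_add_one, Nat.reduceAdd, Fin.isValue, Fin.mk_one,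
            Fin.reduceFinMk, Fin.zero_eta, Function.comp_apply, Fin.succ_zero_eq_one, add_zero]
      map_smul' := fun a X => by
        ext i j; fin_cases i <;> fin_cases j <;>
          simp only [Matrix.smul_apply, smul_eq_mul, mul_zero, RingHom.id_apply, Matrix.of_apply, Matrix.cons_val', Matrix.cons_val_zero, Matrix.cons_val_one,
            Matrix.cons_val_two, Matrix.cons_val_fin_one, Matrix.empty_val', Matrix.vecHead, Matrix.vecTail, Nat.succ_eq_add_one, Nat.reduceAdd, Fin.isValue,
            Fin.mk_one, Fin.reduceFinMk, Fin.zero_eta, Function.comp_apply, Fin.succ_zero_eq_one] }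
  -- ONE inline normed-ring frame (the method of ★ `UltrametricElementwiseNormCalculus` ∕ ★ E1)
  letI : NormedRing (Matrix (Fin 3) (Fin 3) K) :=
    { Matrix.normedAddCommGroup, (inferInstance : Ring (Matrix (Fin 3) (Fin 3) K)) with
      norm_mul_le := Literature.Analysis.Matrix.norm_mul_le_of_isUltrametricDist }
  letI : NormedAlgebra K (Matrix (Fin 3) (Fin 3) K) := { (inferInstance : Algebra K (Matrix (Fin 3) (Fin 3) K)) with norm_smul_le := norm_smul_le }
  haveI : CompleteSpace (Matrix (Fin 3) (Fin 3) K) := inferInstanceAs (CompleteSpace (Fin 3 → Fin 3 → K))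
  suffices key : HasStrictFDerivAt (fun X : Matrix (Fin 3) (Fin 3) K =>
        (1 + (!![0, 0, 0; 0, 0, 0; X 2 0, X 2 1, 0] : Matrix (Fin 3) (Fin 3) K)) *
          (!![m 0, m 1, 0; m 2, m 3, 0; 0, 0, m 4] + !![X 0 0, X 0 1, X 0 2; X 1 0, X 1 1, X 1 2; 0, 0, X 2 2]) *
          (1 - !![0, 0, 0; 0, 0, 0; X 2 0, X 2 1, 0])) e 0 by exact key
  set Pl : Matrix (Fin 3) (Fin 3) K →L[K] Matrix (Fin 3) (Fin 3) K := LinearMap.toContinuousLinearMap Ll with hPl_def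
  set Pp : Matrix (Fin 3) (Fin 3) K →L[K] Matrix (Fin 3) (Fin 3) K := LinearMap.toContinuousLinearMap Lp with hPp_def
  have hPl : ∀ X, Pl X = !![0, 0, 0; 0, 0, 0; X 2 0, X 2 1, 0] := fun X => rfl
  have hPp : ∀ X, Pp X = !![X 0 0, X 0 1, X 0 2; X 1 0, X 1 1, X 1 2; 0, 0, X 2 2] := fun X => rfl
  have hA : HasStrictFDerivAt (fun X : Matrix (Fin 3) (Fin 3) K => (1 : Matrix (Fin 3) (Fin 3) K) + Pl X) Pl 0 := Pl.hasStrictFDerivAt.const_add 1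
  have hB : HasStrictFDerivAt (fun X : Matrix (Fin 3) (Fin 3) K => (!![m 0, m 1, 0; m 2, m 3, 0; 0, 0, m 4] : Matrix (Fin 3) (Fin 3) K) + Pp X) Pp 0 :=
    Pp.hasStrictFDerivAt.const_add _
  have hC : HasStrictFDerivAt (fun X : Matrix (Fin 3) (Fin 3) K => (1 : Matrix (Fin 3) (Fin 3) K) - Pl X) (-Pl) 0 := Pl.hasStrictFDerivAt.const_sub 1
  -- the two products
  have h₃ := (hA.mul' hB).mul' hC
  -- identify the map and the derivative
  have hfun : (fun X : Matrix (Fin 3) (Fin 3) K =>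
        (1 + (!![0, 0, 0; 0, 0, 0; X 2 0, X 2 1, 0] : Matrix (Fin 3) (Fin 3) K)) *
          (!![m 0, m 1, 0; m 2, m 3, 0; 0, 0, m 4] + !![X 0 0, X 0 1, X 0 2; X 1 0, X 1 1, X 1 2; 0, 0, X 2 2]) *
          (1 - !![0, 0, 0; 0, 0, 0; X 2 0, X 2 1, 0])) =
      ((fun X : Matrix (Fin 3) (Fin 3) K => (1 : Matrix (Fin 3) (Fin 3) K) + Pl X) *
          fun X => (!![m 0, m 1, 0; m 2, m 3, 0; 0, 0, m 4] : Matrix (Fin 3) (Fin 3) K) + Pp X) *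
        fun X => (1 : Matrix (Fin 3) (Fin 3) K) - Pl X := by
    funext X
    simp only [Pi.mul_apply, hPl, hPp]
  rw [hfun]
  refine h₃.congr_fderiv (ContinuousLinearMap.ext fun v => ?_)
  have h0l : Pl 0 = 0 := map_zero _
  have h0p : Pp 0 = 0 := map_zero _
  -- evaluate the product-rule derivative at `v`: `f x • g' + f' <• g x` pointwise, base values `1`, `M(m)`, `1`
  ext i j
  simp only [_root_.add_apply, _root_.smul_apply, Pi.mul_apply, op_smul_eq_mul, smul_eq_mul, h0l, h0p, add_zero, one_mul, sub_zero, MulOpposite.op_one,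
    one_smul]
  refine Eq.trans ?_ (congrFun (congrFun (he v) i) j).symm
  -- the remaining identity of concrete `3 × 3` matrices (§1), read through the definitional unfoldings `Pl v = L v`, `Pp v = v_𝔭`
  exact derivative_entry_formula m v i j

/-- **THE STRICT DERIVATIVE OF THE PARABOLIC CHART AT `0`**: for `χ(m) ≠ 0` there is a continuous linear AUTOMORPHISM `e_m` of `M₃(K)` acting as the row action with
`HasStrictFDerivAt Φ_m e_m 0`. [cite: HarishChandra1970, Part V §4 Lemma 22] [cite: Schikhof1984, §27] -/
theorem hasStrictFDerivAt_parabolicChart (m : Fin 5 → K) (hm : (m 4 - m 0) * (m 4 - m 3) - m 1 * m 2 ≠ 0) :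
    ∃ e : Matrix (Fin 3) (Fin 3) K ≃L[K] Matrix (Fin 3) (Fin 3) K,
      (∀ X, e X = !![X 0 0, X 0 1, X 0 2; X 1 0, X 1 1, X 1 2; X 2 0 * (m 0 - m 4) + X 2 1 * m 2, X 2 0 * m 1 + X 2 1 * (m 3 - m 4), X 2 2]) ∧
      HasStrictFDerivAt (fun X : Matrix (Fin 3) (Fin 3) K =>
        (1 + (!![0, 0, 0; 0, 0, 0; X 2 0, X 2 1, 0] : Matrix (Fin 3) (Fin 3) K)) *
          (!![m 0, m 1, 0; m 2, m 3, 0; 0, 0, m 4] + !![X 0 0, X 0 1, X 0 2; X 1 0, X 1 1, X 1 2; 0, 0, X 2 2]) *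
          (1 - !![0, 0, 0; 0, 0, 0; X 2 0, X 2 1, 0]))
        (e : Matrix (Fin 3) (Fin 3) K →L[K] Matrix (Fin 3) (Fin 3) K) 0 := by
  obtain ⟨e, he⟩ := exists_rowActionEquiv m hm
  exact ⟨e, he, hasStrictFDerivAt_parabolicChart_of m (e : Matrix (Fin 3) (Fin 3) K →L[K] Matrix (Fin 3) (Fin 3) K) he⟩

end Normed

end Summit.HodgeConjecture.HodgeConjecture.Cruxes.H413.K2E3GL3ParabolicChartDeriv

end
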